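import Literature.NumberTheory.DiophantineGeometry.AbcGyory2008
import Literature.IUT.LogVolume.FakeAdeleIndex
import Mathlib.NumberTheory.NumberField.Units.DirichletTheorem
import Mathlib.NumberTheory.NumberField.Discriminant.Defs
import Mathlib.NumberTheory.Height.NumberField
import HarnessLib

/-!
# Győry 2008 (Acta Arith. 133), §3: the effective bounds towards the uniform `abc` conjecture in NUMBER FIELDS

Topic `NumberTheory/DiophantineGeometry`; namespace `Literature.NumberTheory.DiophantineGeometry`
(API in the sub-namespace `Gyory2008`). Sequel to `AbcGyory2008.lean` (the `K = ℚ` statements); this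
file types the GENERAL form recorded there as `TODO(general form)`.

Source: K. Győry, *On the abc conjecture in algebraic number fields*, Acta Arith. **133** (2008),
281–295 [Gyory2008] — HELD (`paper:doi-10-4064-aa133-3-6`), §3 pp. 284–287 and the proof §4
pp. 288–292, read on the page. Setting (§3, p. 284–285): `K` a number field of degree `d`, unit rank
`r`, `Δ_K` the absolute value of its discriminant; for `v ∈ M_K` the absolute value `|·|_v` is
`|σ(·)|^{d_v}` (`d_v = 1, 2`) at an infinite place and `N(𝔭)^{−ord_𝔭}` at a finite one, so that
(3.1) `H_K(a, b, c) = ∏_v max(|a|_v, |b|_v, |c|_v)` is the RELATIVE multiplicative height of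
`(a : b : c)` — Mathlib's `Height.mulHeight ![a, b, c]` over `K` (as in the tree's
`UniformABCConjecture`, abc.S21, whose docstring records this normalisation);
(3.2) `N_K(a, b, c) = ∏ N(𝔭)^{ord_𝔭 p}` (with `pℤ = 𝔭 ∩ ℤ`, i.e. the exponent is the ramification
index `e(𝔭 | p)`), the product over the finite `v = 𝔭` at which `|a|_v, |b|_v, |c|_v` are NOT all
equal — the tree's `badPrimes a b c` (`AbcWave0`) — typed here as `Gyory2008.radicalK` (it is NOT the
tree's `radicalNorm`, which is `∏ N(𝔭)` without the exponents `e_𝔭`; `radicalNorm ∣ radicalK`). DEDUP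
RECORD: `radicalK` is THE SAME quantity as Masser's support `S_K(a, b, c)`, already in the tree as
`Literature.Barriers.ABC.masserSupport` (typed with Mathlib's `Ideal.ramificationIdx ℤ` instead of
`LogVolume.ramIdx`) — PROVED equal: `Gyory2008.radicalK_eq_masserSupport`
(`AbcGyory2008RatOfNumberFieldsProofs.lean`); the name `radicalK` is kept as Győry's `N_K` and the two are
interchangeable;
"`P_K(a, b, c)` the greatest factor `N(𝔭)` in (3.2)" — `Gyory2008.maxNorm`; `log* x = max(log x, 1)`
(`Dioph.logStar`), `logᵢ` the iterated logarithm, `N⋆ = max(N, 16)`.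

Typed: ONE named fact `gyory2008_thm1` (it rests on Theorem A = Győry–Yu 2006, linear forms in
logarithms), the conjunction of the two displays of **Theorem 1** (p. 286):
* (3.7), for triples with at least one finite bad place (`t > 0`; the case the proof of (3.7) treats,
  pp. 290–292 "Next consider the case `t > 0`"; `P` is undefined for `t = 0`):
  `log H_K(a,b,c) < c₁₃ Δ_K^{3/2} (log* Δ_K)^{3d−1} (P / log* P) N^{d (c₁₄ log* Δ_K + 19.2 log₃ N⋆) / log₂ N⋆}`
  with the printed table `c₁₃ = 2²³ (d = 1), 2²⁷ (d = 2, r = 0), 2⁹⁸ d⁸ (log* d)⁶ (r = 1),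
  (r+1)^{5r+14} 2^{10r+74} d^{r+8} (log 2d)⁸ (r ≥ 2)`; `c₁₄ = 12.4 (d = 1), 14.7 (d = 2, r = 0), 7.4 d (r = 1),
  2.9 d log d (r ≥ 2)` (`Gyory2008.c13`, `Gyory2008.c14`) — projection `Gyory2008.thm1_general`;
* (3.8), the case `S = S_∞` ("i.e. if `a/c, b/c ∈ O_K^*`", no finite bad place):
  `log H_K(a,b,c) < c₁₅ Δ_K^{1/2} (log* Δ_K)^d`, `c₁₅ = (r+1)^{2r+9} 2^{4(r+2)} (d log* (2d))⁴`
  (`Gyory2008.c15`) — projection `Gyory2008.thm1_units`.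
NOT vendored (it is "a consequence of Theorem 1", proof p. 292): **Theorem 2** — (3.9) for every `ε > 0`,
`log H_K(a,b,c) < c₁₆(d, Δ_K, ε) N^{1+ε}`; (3.10) if `N > max(exp exp max(Δ_K, e), Δ_K^{2/ε})` then
`log H_K(a,b,c) < c₁₇(d, ε) (Δ_K N)^{1+ε}`, uniform in `Δ_K` "towards the truth of the uniform abc
conjecture" (3.3) (the tree's `UniformABCConjecture`, which asserts `H_K < C^d (Δ_K N_K)^{1+ε}` for the
height itself, not its logarithm, and with `radicalNorm ≤ radicalK`). (3.9) is PROVED from this fact in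
`AbcGyory2008ThmTwoProofs.lean` (`Gyory2008.thm2_of_thm1`, per field `K`; with `Gyory2008.badPrimes_finite`:
for `a, b, c ≠ 0` the bad primes are finitely many, so no junk values occur; `Gyory2008.thm2_of_thm1_uniform`
with the printed dependence `c₁₆ = c₁₆(d, Δ_K, ε)`), and so is (3.10) (`Gyory2008.thm2_uniform_of_thm1`,
`c₁₇ = c₁₇(d, ε)`, the deduction of p. 292–293).

The `K = ℚ` sentence of Theorem 1 (p. 287) is `gyory2008_thm1_rat` of `AbcGyory2008.lean`
(`d = 1`, `r = 0`, `Δ = 1`: `c₁₃ = 2²³`, `c₁₄ log* 1 + 19.2 log₃ N⋆ ≤ 653 log₃ N⋆`); the kernel bridge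
`gyory2008_thm1 → gyory2008_thm1_rat` is PROVED in `AbcGyory2008RatOfNumberFieldsProofs.lean`
(`Gyory2008.thm1_rat_of_thm1`: `mulHeight ![a, b, −c] = c`, `radicalK = rad` over `ℚ` via `ramIdx ℚ v = 1`,
`maxNorm = P(abc)`, and `log₃ 16 > 0.01957` certified, so the printed `653` is kernel-checked). PROVED here: unfolding lemmas, the `d = 1` values of the constants
(`Gyory2008.c13_one`, `Gyory2008.c14_one`), positivity of the exponent (`Gyory2008.thm1Exponent_pos`),
`radicalNorm ∣ radicalK` for finitely many bad primes (`Gyory2008.radicalNorm_dvd_radicalK`).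

Faithfulness notes. (i) Hypothesis (3.4) is `a + b + c = 0`, `a, b, c ∈ K*` — typed verbatim (not the
tree's `a + b = c` convention; heights and bad primes are insensitive to `c ↦ −c`, but that is not used).
(ii) The exponent of `N` in (3.7) is typed with BOTH iterated logarithms at `N⋆` — as the proof has it
((4.14) "`t < 1.5 d log N / log₂ N⋆`", (4.17) "`∏ log N(𝔭ᵢ) ≤ (1/d^t) N^{19.16 d log₃ N⋆ / log₂ N⋆}`",
(4.24)); confirmed on the page render of p. 286 (`HOME/lit/renders/Gyory2008_p286.png`, abc-stewartyu lit desk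
g7, 2026-08-26): the display (3.7) carries `N⋆` in BOTH iterated logarithms and `log*` on `Δ_K`. (iii) `P/log* P`
with `P = maxNorm ≥ 2` when `t > 0`. (iv) The degenerate junk values (`radicalK = 1`, `maxNorm = 0` when
the set of bad primes is infinite, i.e. when one of `a, b, c` is `0`) are excluded by the hypotheses
`a, b, c ≠ 0`. (v) "effectively computable" is automatic for (3.7)/(3.8) (explicit constants). (vi) The
unit rank `r` is Mathlib's `NumberField.Units.rank K`, `d = Module.finrank ℚ K`, `Δ_K = |NumberField.discr K|`.
Nothing here bears on `abc` over `ℚ` beyond `AbcGyory2008.lean`; these are Baker-method records.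

## References

* [Gyory2008] K. Győry, *On the abc conjecture in algebraic number fields*, Acta Arith. 133 (2008),
  281–295, doi:10.4064/aa133-3-6 — §3 (3.1)–(3.10) pp. 284–287; §4 pp. 288–292.
* [GyoryYu2006] K. Győry, K. Yu, *Bounds for the solutions of S-unit equations and decomposable form
  equations*, Acta Arith. 123 (2006), 9–41 — Theorem A's source.
* [GranvilleStark2000] A. Granville, H. M. Stark, Invent. Math. 139 (2000) — eq. (1) (the uniform
  conjecture, tree `UniformABCConjecture`).
-/

noncomputable section

open Real NumberField IsDedekindDomain
open Literature.NumberTheory.DiophantineGeometry.Dioph (logStar logStar_def one_le_logStar)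
open Literature.IUT.LogVolume (ramIdx)

namespace Literature.NumberTheory.DiophantineGeometry

namespace Gyory2008

section NumberField

variable {K : Type*} [Field K] [NumberField K]

/-- Győry's radical (3.2): `N_K(a, b, c) = ∏ N(𝔭)^{e(𝔭|p)}` over the finite places `𝔭` at which the
`𝔭`-adic absolute values of `a, b, c` are not all equal (`badPrimes a b c`); junk value `1` if that set
is infinite (which does not happen for `a, b, c ≠ 0`: `Gyory2008.badPrimes_finite`). Compare the tree's
`radicalNorm a b c = ∏ N(𝔭)` (Granville–Stark's conductor, no ramification exponents). EQUAL to Masser's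
support `Literature.Barriers.ABC.masserSupport a b c` (`Gyory2008.radicalK_eq_masserSupport`, proved).
[cite: Gyory2008, §3 (3.2), p. 285] -/
def radicalK (a b c : K) : ℕ :=
  ∏ᶠ v ∈ badPrimes a b c, Ideal.absNorm v.asIdeal ^ ramIdx K v

/-- Unfolding lemma for `radicalK`. [cite: Gyory2008, §3 (3.2), p. 285] -/
theorem radicalK_def (a b c : K) :
    radicalK a b c = ∏ᶠ v ∈ badPrimes a b c, Ideal.absNorm v.asIdeal ^ ramIdx K v :=
  rfl

/-- `P_K(a, b, c)`, "the greatest factor `N(𝔭)` in (3.2)": the largest norm of a bad prime (junk `0`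
when there is no bad prime or infinitely many). [cite: Gyory2008, §3, p. 285] -/
def maxNorm (a b c : K) : ℕ :=
  ⨆ v : badPrimes a b c, Ideal.absNorm v.1.asIdeal

/-- Unfolding lemma for `maxNorm`. [cite: Gyory2008, §3, p. 285] -/
theorem maxNorm_def (a b c : K) :
    maxNorm a b c = ⨆ v : badPrimes a b c, Ideal.absNorm v.1.asIdeal :=
  rfl

/-- For finitely many bad primes, Granville–Stark's `radicalNorm` divides Győry's `radicalK`
(exponents `e_𝔭 ≥ 1`). [cite: Gyory2008, §3 (3.2), p. 285] -/
theorem radicalNorm_dvd_radicalK {a b c : K} (hfin : (badPrimes a b c).Finite) :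
    radicalNorm a b c ∣ radicalK a b c := by
  classical
  unfold radicalNorm radicalK
  rw [finprod_mem_eq_finite_toFinset_prod _ hfin, finprod_mem_eq_finite_toFinset_prod _ hfin]
  exact Finset.prod_dvd_prod_of_dvd _ _ fun v _ =>
    dvd_pow_self _ (Literature.IUT.LogVolume.ramIdx_ne_zero K v)

end NumberField

/-! ### The constants of Theorem 1 (p. 286) -/

/-- `c₁₃ = c₁₃(d, r)`: `2²³` if `d = 1`; `2²⁷` if `d = 2` and `r = 0`; `2⁹⁸ d⁸ (log* d)⁶` if `r = 1`
(with `log*`, as printed in the statement of Theorem 1, p. 286 — checked on the page render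
`HOME/lit/renders/Gyory2008_p286.png`; the proof p. 292 writes `(log d)⁶`, a smaller value);
`(r+1)^{5r+14} 2^{10r+74} d^{r+8} (log 2d)⁸` if `r ≥ 2` (for a number field, `r = 0` iff `d = 1` or `K` is
imaginary quadratic, so the table is exhaustive; other pairs `(d, 0)` get the `r ≥ 2` formula as junk).
[cite: Gyory2008, §3 Theorem 1, p. 286] -/
def c13 (d r : ℕ) : ℝ :=
  if d = 1 then 2 ^ 23
  else if d = 2 ∧ r = 0 then 2 ^ 27
  else if r = 1 then 2 ^ 98 * (d : ℝ) ^ 8 * logStar d ^ 6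
  else ((r : ℝ) + 1) ^ (5 * r + 14) * 2 ^ (10 * r + 74) * (d : ℝ) ^ (r + 8) * Real.log (2 * d) ^ 8

/-- `c₁₄ = c₁₄(d, r)`: `12.4` if `d = 1`; `14.7` if `d = 2` and `r = 0`; `7.4 d` if `r = 1`; `2.9 d log d`
if `r ≥ 2`. [cite: Gyory2008, §3 Theorem 1, p. 286] -/
def c14 (d r : ℕ) : ℝ :=
  if d = 1 then 12.4
  else if d = 2 ∧ r = 0 then 14.7
  else if r = 1 then 7.4 * d
  else 2.9 * d * Real.log d

/-- `c₁₅ = (r+1)^{2r+9} 2^{4(r+2)} (d log* (2d))⁴`, the constant of (3.8).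
[cite: Gyory2008, §3 Theorem 1 (3.8), p. 286] -/
def c15 (d r : ℕ) : ℝ :=
  ((r : ℝ) + 1) ^ (2 * r + 9) * 2 ^ (4 * (r + 2)) * ((d : ℝ) * logStar (2 * d)) ^ 4

/-- `c₁₃(1, r) = 2²³`. [cite: Gyory2008, p. 286 and p. 292 ("`c₁₃ = 2²³, c₁₄ = 12.4 if d = 1`")] -/
theorem c13_one (r : ℕ) : c13 1 r = 2 ^ 23 := by simp [c13]

/-- `c₁₄(1, r) = 12.4`. [cite: Gyory2008, p. 286 and p. 292] -/
theorem c14_one (r : ℕ) : c14 1 r = 12.4 := by simp [c14]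

/-- The exponent of `N` in (3.7): `d (c₁₄ log* Δ_K + 19.2 log₃ N⋆) / log₂ N⋆`, `N⋆ = max(N, 16)`.
[cite: Gyory2008, §3 Theorem 1 (3.7), p. 286] -/
def thm1Exponent (d r : ℕ) (Δ N : ℝ) : ℝ :=
  d * (c14 d r * logStar Δ + 19.2 * Real.log (Real.log (Real.log (max N 16)))) /
    Real.log (Real.log (max N 16))

/-- Unfolding lemma for `thm1Exponent`. [cite: Gyory2008, §3 Theorem 1 (3.7), p. 286] -/
theorem thm1Exponent_def (d r : ℕ) (Δ N : ℝ) :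
    thm1Exponent d r Δ N = d * (c14 d r * logStar Δ + 19.2 * Real.log (Real.log (Real.log (max N 16)))) /
      Real.log (Real.log (max N 16)) :=
  rfl

end Gyory2008

open Gyory2008

/-! ### Theorem 1 -/

/-- **Győry 2008, Theorem 1** (p. 286), both displays, as ONE named fact (a conjunction):
(3.7) *"If `a, b, c ∈ K*` satisfy (3.4) [`a + b + c = 0`], then
`log H_K(a, b, c) < c₁₃ Δ_K^{3/2} (log* Δ_K)^{3d−1} (P / log* P) N^{d (c₁₄ log* Δ_K + 19.2 log₃ N⋆) / log₂ N⋆}`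
where `P = P_K(a, b, c)`, `N = N_K(a, b, c)`, `N⋆ = max(N, 16)`"* with the tabulated `c₁₃, c₁₄`
(`Gyory2008.c13`, `Gyory2008.c14`; `d = [K : ℚ]`, `r` = unit rank, `Δ_K = |disc K|`) — typed for triples
with at least one finite bad place (`t > 0`: there `P` is defined, and it is the case the proof of (3.7)
treats, pp. 290–292 "Next consider the case `t > 0`"); and (3.8) *"If in particular `S = S_∞` (i.e. if
`a/c, b/c ∈ O_K^*`), then `log H_K(a, b, c) < c₁₅ Δ_K^{1/2} (log* Δ_K)^d`, where
`c₁₅ = (r+1)^{2r+9} 2^{4(r+2)} (d log* (2d))⁴`"* — no finite bad place (`badPrimes a b c = ∅`).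
`H_K` = Mathlib's relative `Height.mulHeight ![a, b, c]`, `N = radicalK`, `P = maxNorm`,
`log* = Dioph.logStar`. Projections: `Gyory2008.thm1_general`, `Gyory2008.thm1_units`. Rests on
Theorem A (Győry–Yu 2006); its `K = ℚ` sentence is `gyory2008_thm1_rat` (`AbcGyory2008.lean`).
Theorem 2 of the paper — (3.9) `log H_K(a,b,c) < c₁₆(d, Δ_K, ε) N^{1+ε}` and, for
`N > max(exp exp max(Δ_K, e), Δ_K^{2/ε})`, (3.10) `log H_K(a,b,c) < c₁₇(d, ε) (Δ_K N)^{1+ε}` (p. 287) — is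
"a consequence of Theorem 1" (proof p. 292, (4.22)–(4.24)) and is deliberately NOT vendored as a further
fact: both displays are PROVED from this one, following p. 292, in `AbcGyory2008ThmTwoProofs.lean`
(`Gyory2008.thm2_of_thm1`, `Gyory2008.thm2_of_thm1_uniform`, `Gyory2008.thm2_uniform_of_thm1`).
[cite: Gyory2008, §3 Theorem 1 (3.7)–(3.8), p. 286] -/
def gyory2008_thm1 : Prop :=
  (∀ (K : Type) [Field K] [NumberField K] (a b c : K), a ≠ 0 → b ≠ 0 → c ≠ 0 → a + b + c = 0 →
    (badPrimes a b c).Nonempty →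
      Real.log (Height.mulHeight ![a, b, c]) <
        c13 (Module.finrank ℚ K) (Units.rank K) *
          (|(discr K : ℝ)|) ^ (3 / 2 : ℝ) *
          logStar |(discr K : ℝ)| ^ (3 * Module.finrank ℚ K - 1) *
          ((maxNorm a b c : ℝ) / logStar (maxNorm a b c)) *
          (radicalK a b c : ℝ) ^
            thm1Exponent (Module.finrank ℚ K) (Units.rank K) |(discr K : ℝ)| (radicalK a b c)) ∧
  (∀ (K : Type) [Field K] [NumberField K] (a b c : K), a ≠ 0 → b ≠ 0 → c ≠ 0 → a + b + c = 0 →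
    badPrimes a b c = ∅ →
      Real.log (Height.mulHeight ![a, b, c]) <
        c15 (Module.finrank ℚ K) (Units.rank K) * (|(discr K : ℝ)|) ^ (1 / 2 : ℝ) *
          logStar |(discr K : ℝ)| ^ Module.finrank ℚ K)

namespace Gyory2008

/-- Theorem 1, display (3.7) (at least one finite bad place). [cite: Gyory2008, §3 Theorem 1 (3.7), p. 286] -/
theorem thm1_general (h : gyory2008_thm1) {K : Type} [Field K] [NumberField K] {a b c : K}
    (ha : a ≠ 0) (hb : b ≠ 0) (hc : c ≠ 0) (habc : a + b + c = 0) (hbad : (badPrimes a b c).Nonempty) :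
    Real.log (Height.mulHeight ![a, b, c]) <
      c13 (Module.finrank ℚ K) (Units.rank K) *
        (|(discr K : ℝ)|) ^ (3 / 2 : ℝ) *
        logStar |(discr K : ℝ)| ^ (3 * Module.finrank ℚ K - 1) *
        ((maxNorm a b c : ℝ) / logStar (maxNorm a b c)) *
        (radicalK a b c : ℝ) ^
          thm1Exponent (Module.finrank ℚ K) (Units.rank K) |(discr K : ℝ)| (radicalK a b c) :=
  h.1 K a b c ha hb hc habc hbad

/-- Theorem 1, display (3.8) (`S = S_∞`: no finite bad place). [cite: Gyory2008, §3 Theorem 1 (3.8), p. 286] -/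
theorem thm1_units (h : gyory2008_thm1) {K : Type} [Field K] [NumberField K] {a b c : K}
    (ha : a ≠ 0) (hb : b ≠ 0) (hc : c ≠ 0) (habc : a + b + c = 0) (hbad : badPrimes a b c = ∅) :
    Real.log (Height.mulHeight ![a, b, c]) <
      c15 (Module.finrank ℚ K) (Units.rank K) * (|(discr K : ℝ)|) ^ (1 / 2 : ℝ) *
        logStar |(discr K : ℝ)| ^ Module.finrank ℚ K :=
  h.2 K a b c ha hb hc habc hbad

/-- The exponent of (3.7) is positive when `c₁₄ ≥ 0` and `d ≥ 1` (`log* Δ ≥ 1`, `log₃ N⋆ > 0`,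
`log₂ N⋆ > 0`). [cite: Gyory2008, §3 Theorem 1 (3.7), p. 286] -/
theorem thm1Exponent_pos {d r : ℕ} (hd : 1 ≤ d) (hc : 0 ≤ c14 d r) (Δ N : ℝ) :
    0 < thm1Exponent d r Δ N := by
  have hℓ := exponent_pos N
  have hpos1 : 0 < Real.log (Real.log (Real.log (max N 16))) := by
    have h := exponent_pos N
    by_contra hle
    push Not at hle
    have hden : 0 < Real.log (Real.log (max N 16)) ∨ Real.log (Real.log (max N 16)) ≤ 0 := lt_or_ge 0 _ |>.imp id id
    rcases hden with hden | hden
    · have : 653 * Real.log (Real.log (Real.log (max N 16))) / Real.log (Real.log (max N 16)) ≤ 0 :=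
        div_nonpos_of_nonpos_of_nonneg (by linarith) hden.le
      linarith
    · -- `log₂ N⋆ > 0` always (`N⋆ ≥ 16`)
      have h16 : Real.exp 1 < Real.log (max N 16) := by
        have h4 : Real.log 16 = 4 * Real.log 2 := by
          rw [show (16 : ℝ) = 2 ^ 4 by norm_num, Real.log_pow]; norm_num
        have : Real.exp 1 < Real.log 16 := by
          rw [h4]; have := Real.log_two_gt_d9; have := Real.exp_one_lt_d9; linarith
        exact lt_of_lt_of_le this (Real.log_le_log (by norm_num) (le_max_right N 16))
      have : 0 < Real.log (Real.log (max N 16)) :=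
        Real.log_pos (by linarith [Real.add_one_le_exp (1 : ℝ)])
      linarith
  have hpos2 : 0 < Real.log (Real.log (max N 16)) := by
    by_contra hle
    push Not at hle
    have : 653 * Real.log (Real.log (Real.log (max N 16))) / Real.log (Real.log (max N 16)) ≤ 0 :=
      div_nonpos_of_nonneg_of_nonpos (by linarith) hle
    linarith
  have hd0 : (0 : ℝ) < d := by exact_mod_cast hd
  have hls : 1 ≤ logStar Δ := one_le_logStar Δ
  unfold thm1Exponent
  apply div_pos _ hpos2
  apply mul_pos hd0
  have : 0 ≤ c14 d r * logStar Δ := mul_nonneg hc (by linarith)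
  linarith

end Gyory2008

end Literature.NumberTheory.DiophantineGeometry
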